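import Summits.AnomalousDissipation.AnomalousDissipation.Theorems.RelaxingFamily.Negative.LinearEnstrophyBudget
import Literature.Analysis.FluidPDE.PassiveScalarForced

/-!
# Disproof of `RelaxingFamily` (stmt-AnomalousDissipation-15009) — findings of the cdisprove seat

Crux: `Summit.AnomalousDissipation.AnomalousDissipation.Theses.LimitingAbsorption.RelaxingFamily`
(route LimitingAbsorption, r3): ∃ steady smooth div-free mean-zero `g`, smooth mean-zero `h ≠ 0`,
`ν_j → 0`, global planar Leray–Hopf `v_j` (force `g`, locally bounded, `meanEnergy ≤ E`) with (U_h):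
phase-uniform, `ν`-uniform exponential `L²` relaxation of `h` by `∂ₜ + v_j(s+·)·∇ − ν_jΔ`.

## Findings (cycle 1, 2026-08-16)

* NO STRUCTURAL KILL. The weak scalar class is robust (iterated integrals are honest by the
  `L^∞_t L²_x`, `uθ ∈ L¹` side conditions; uniqueness for bounded drift is in tree,
  `KinematicSteadySourceLaw.ae_eq_of_memLp_top`), `meanEnergy` is an honest `limsup` for mean-zero
  steady forces (FMRT (3.2), `Torus.IsGlobalLerayHopf.isBoundedUnder_timeMean_energy`), `T ≤ 0` and
  `C`-junk are harmless, Galilean drift is scale-consistent (relaxation is frame-invariant). The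
  statement is of open-problem grade in BOTH polarities (Kraichnan–Batchelor predicts `¬`; no
  sub-polynomial enstrophy law for bounded-energy steadily forced planar NS is known).
* LOAD-BEARING ANALYSIS = the Seis floor, now a family of UNCONDITIONAL `¬ RelaxingFamilyUnder <class>`
  theorems under `Theorems/RelaxingFamily/Negative/` (shape: the crux verbatim + one extra hypothesis):
  - lead (p97152, `LinearEnstrophyBudget.lean`): `LinearEnstrophyBudget` (Seis Rmk 1 class),
    `BoundedEnstrophy` (T2), `QuadraticEnstrophyBudget` (time-averaged enstrophy);
  - this seat (p99274, `FiniteEnstrophy.lean`): the ENERGY CLAUSE of those classes is automatic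
    (`exists_lintegral_translate_le`) ⇒ budget-only classes `LinearEnstrophyBudget₀`,
    `QuadraticEnstrophyBudget₀`; `FiniteEnstrophyDissipation` (`∫₀^∞‖∇v_j‖₂² < ∞` per level, NO
    uniformity) and its corollary `relaxingFamily_false_without_forcing` (`g = 0` is admitted by the
    signature and is dead);
  - this seat (`SingleShell.lean`, p100987): `relaxingFamily_false_without_multiShell :
    ¬ RelaxingFamilyUnder SingleShell` — the route's "natural first theorem": restart at a good time
    (no hypothesis on `v₀`), every-solution ShellPincer pincer, honest Cesàro energy, ARG-MAX PHASE
    lemma (`exists_phase_linear_budget`: a Cesàro bound `∫₀ᵀ f ≤ AT` for `T ≥ T₀` yields a phase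
    `s < T₀` with `∫ₛ^{s+t} f ≤ (2A+1)t` for ALL `t > 0` — reusable for any time-averaged bound);
  - this seat (`WeakScalarTimeDilation.lean`, p102593, the tool; `SublogBudget.lean`, p104210): the QUANTITATIVE floor
    `relaxingFamily_false_without_logEnstrophy : ¬ RelaxingFamilyUnder SublogEnstrophyBudget`
    (level-dependent homogeneous slopes `M_j = o(log(1/ν_j))` excluded; `_liminf` form: excluded even
    along a subsequence) via the new TOOL `isWeakScalarTransportOn_comp_mul` (time dilation of
    `Torus.IsWeakScalarTransportOn` weak solutions — Seis' scaling note made formal), plus the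
    SUBSEQUENCE PRINCIPLE `RelaxingFamilyUnder.subseq` / `relaxingFamilyUnder_frequently_imp`
    (per-level classes need only hold at infinitely many levels; corollaries for finite total enstrophy /
    bounded enstrophy at infinitely many levels in `FrequentLevels.lean`, p111194).
  Reading for provers: a witness must (i) force ≥ 2 shells, (ii) dissipate infinite total enstrophy,
  (iii) from EVERY phase have windowed mean `‖∇v_j‖_{L²} ≥ (γ/2K₁) log(1/ν_j)` for all large `j`
  (`K₁ = K₁(h, C)` Seis' slope-1 constant) — mean enstrophy `≳ γ² log²(1/ν_j)` — at bounded energy.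
* TARGETS (line `Sketch`, stub `stub_hull : HullRelaxingFamily`): not attackable separately — the hull
  form is the crux with "∀ phases of one trajectory" traded for "phase 0 on a shift-invariant family"
  (`hull_imp_relaxingFamily_holds`; converse modulo restarting), so `stub_hull_false` would be `¬` crux.
  The lead declared the line dead (`Lines/Sketch-dead.md`); nothing to break below the crux.
* NEAR-MISSES (typed below, `sorry` — allowed only in this workfile): N2 collinear torque (T1: needs the
  weak VORTICITY formulation of planar Leray–Hopf solutions in `L^∞_t L²_x`, absent from the tree),
  N3 material-rate comparison (T4: needs a pointwise-in-time forced energy inequality; the tree's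
  `energy_ineq_of_lintegral_eGradNormSq_rpow_lt_top` bounds only the dissipation). N1 (log floor) is
  CLOSED (`SublogBudget.lean`).

## Why it resists (one paragraph for the planner)
Every family that present mathematics can construct AND certify along `ν_j → 0` for a fixed `g` sits in
one of the excluded classes (bounded / linearly budgeted / finitely dissipated enstrophy, single shell,
laminar or condensate limits); what survives must carry windowed mean `‖∇v_j‖₂ ≳ log(1/ν_j)` from every
phase at energy `O(1)` — a rough multiscale regime with no invariant-set theory. Conversely `¬RelaxingFamily`
needs a universal sub-log enstrophy law (K–B: `Z ~ log^{2/3}`) for which only `Z ≲ ν^{-1/2}` is proved.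
-/

noncomputable section

open MeasureTheory Set Filter Function TopologicalSpace Topology
open scoped ENNReal NNReal InnerProductSpace

namespace Summit.AnomalousDissipation.AnomalousDissipation.Cruxes.RelaxingFamily.Disproof

set_option linter.dupNamespace false

open Literature.Analysis.FunctionSpaces Literature.Analysis.FunctionSpaces.Torus
open Literature.Analysis.FluidPDE Literature.Analysis.FluidPDE.Torus
open Summit.AnomalousDissipation.AnomalousDissipation.Theses.LimitingAbsorption
open Summit.AnomalousDissipation.AnomalousDissipation.Theorems.RelaxingFamily.Negative

/-- The unit flat 2-torus (local notation). -/
local notation "𝕋²" => UnitAddTorus (Fin 2)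
/-- Planar vectors (local notation). -/
local notation "E²" => EuclideanSpace ℝ (Fin 2)

/-! ## (a) Load-bearing analysis — landed (see the docblock); re-exported reading -/

/-- Reading of the landed floor for provers: any witness leaves the Seis class from every phase.
(Contrapositive packaging of `relaxingFamily_false_without_superlinearEnstrophy`, p97152.) -/
theorem witness_exceeds_every_linear_budget
    (hW : RelaxingFamily) :
    ¬ ∃ (g : 𝕋² → E²) (h : 𝕋² → ℝ), IsSmooth g ∧ IsDivFree g ∧ HasZeroMean g ∧
      IsSmooth h ∧ HasZeroMean h ∧ h ≠ 0 ∧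
      ∃ (ν : ℕ → ℝ) (v₀ : ℕ → 𝕋² → E²) (v : ℕ → ℝ → 𝕋² → E²),
        (∀ j, 0 < ν j) ∧ Tendsto ν atTop (𝓝 0) ∧
        (∀ j, IsGlobalLerayHopf (ν j) (fun _ => g) (v₀ j) (v j)) ∧
        (∀ j (T : ℝ), 0 < T → MemLp (stLift (v j)) ⊤ (volume.restrict (Ioo (0 : ℝ) T ×ˢ univ))) ∧
        (∃ E : ℝ, ∀ j, meanEnergy (v j) ≤ E) ∧
        LinearEnstrophyBudget g h ν v ∧
        ∃ C γ : ℝ, 0 ≤ C ∧ 0 < γ ∧ RelaxesUniformly ν v h C γ := by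
  intro hB
  have _ := hW
  exact relaxingFamily_false_without_superlinearEnstrophy hB

/-! ## (e) Near-misses (typed targets for the next seat; `sorry` only here) -/

/-! N1 (quantitative log floor) — CLOSED: `SublogEnstrophyBudget`,
`relaxingFamily_false_without_logEnstrophy(_liminf)` and the dilation tool
`isWeakScalarTransportOn_comp_mul` live in `Theorems/RelaxingFamily/Negative/SublogBudget.lean`. -/

/-- The planar scalar curl `∂₀w₁ − ∂₁w₀` (no tree-level `Torus.planarCurl` yet). -/
def planarCurl (w : 𝕋² → E²) (x : 𝕋²) : ℝ :=
  Torus.gradient (fun y => w y 1) x 0 - Torus.gradient (fun y => w y 0) x 1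

/-- N2 class — the released profile is collinear with the torque: `h = c · curl g`. -/
def CollinearTorque (g : 𝕋² → E²) (h : 𝕋² → ℝ) (_ν : ℕ → ℝ) (_v : ℕ → ℝ → 𝕋² → E²) : Prop :=
  ∃ c : ℝ, ∀ x, h x = c * planarCurl g x

/-- **N2 (T1 of ideator 1, `RelaxingFamily_false_without_transversality`).** At Pr = 1 the vorticity
`ω_j = curl v_j` solves the crux's own scalar equation with source `curl g`; Duhamel + `L²`-contractivity
turn (U_{c·curl g}) into a `j`-uniform late-time enstrophy bound, i.e. `BoundedEnstrophy`, dead by p97152.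
OBSTRUCTION: needs the weak VORTICITY formulation for planar Leray–Hopf solutions as
`Torus.IsWeakScalarTransportForced (ν_j) (v_j) (fun _ => curl g) ω₀ ω_j` in `L^∞_t L²_x` (2-D enstrophy
class from `L²` data after a restart at an `H¹` time, `exists_isGlobalLerayHopf_translate` gives
`‖∇v(s)‖₂ < ∞`) — the tree has the vorticity equation only for classical solutions. Size M–L. -/
theorem collinearTorque_noGo : ¬ RelaxingFamilyUnder CollinearTorque := by
  sorry

/-- **N3 (T4, tool) material-rate comparison**: a sourced weak scalar and the unsourced release from the
same slice drift apart at most linearly in `L²`. Provable now from the forced toolkit (difference solves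
the sourced problem from zero datum; energy inequality for bounded drift + Minkowski); not needed by any
landed lemma yet, recorded for N2 / the census lemma. -/
theorem materialRateComparison
    (κ : ℝ) (u : ℝ → 𝕋² → E²) (f ω₀ : 𝕋² → ℝ) (ω ϑ : ℝ → 𝕋² → ℝ) (T : ℝ)
    (hκ : 0 < κ) (hf : MemLp f 2 volume) (hω₀ : MemLp ω₀ 2 volume)
    (hu : ∀ T' : ℝ, 0 < T' → MemLp (stLift u) ⊤ (volume.restrict (Ioo (0 : ℝ) T' ×ˢ univ)))
    (hω : IsWeakScalarTransportForced κ u (fun _ => f) ω₀ ω)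
    (hϑ : IsWeakScalarTransportOn T κ u ω₀ ϑ) :
    ∀ᵐ t ∂(volume.restrict (Ioo (0 : ℝ) T)),
      scalarL2Sq (fun x => ω t x - ϑ t x) ≤ t ^ 2 * scalarL2Sq f := by
  sorry

end Summit.AnomalousDissipation.AnomalousDissipation.Cruxes.RelaxingFamily.Disproof

end
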